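import Summits.AtomisticToContinuum.HydrodynamicLimit.Theses.JParityClosure
import Summits.AtomisticToContinuum.HydrodynamicLimit.Theorems.JParityClosureParityRigidityMollify
import Summits.AtomisticToContinuum.HydrodynamicLimit.Theorems.JParityClosureParityRigidityIdentify
import Literature.Barriers.CriticalPhenomena.RigorousRGSmallParameterFlowExponent
import Mathlib.MeasureTheory.Measure.ProbabilityMeasure
import Mathlib.MeasureTheory.Measure.FiniteMeasure
import Mathlib.Topology.UniformSpace.Ascoli
import Mathlib.Topology.MetricSpace.UniformConvergence
import Mathlib.Analysis.Calculus.MeanValue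
import HarnessLib

/-!
# Gaussian KDEs along weakly convergent laws: locally uniform convergence of the surprisal jump
(helper A for the stub `stub_surprisalTestContinuity`)

Helper file for the waypoint `SurprisalTestContinuity` of the line `transfer-weighted-parity-chain` (skeleton v3) of
the crux `JParityClosure.ParityBandClosure` (stmt-AtomisticToContinuum-17608).  Conventions VERBATIM those of the
skeleton: the Gaussian KDE of a law `μ` on `V3 = ℝ³` at bandwidth `ϑ` is `h^μ_ϑ(v) = ∫ localMaxwellian 1 ϑ² v v' dμ(v')`,
the surprisal jump across a collision of a record point `q ∈ Q = (ℝ³ × ℝ³) × S²` is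
`F^μ_ϑ(q) = log h(q.1.1) + log h(q.1.2) - log h((collide q.2 q.1).1) - log h((collide q.2 q.1).2)`, and the
Metropolis-weighted mark is `Ψ(q) min(1, e^{-F^μ_ϑ(q)})`.  No new definitions are introduced: the KDE is written
`∫ w, localMaxwellian 1 (ϑ ^ 2) v w ∂μ` throughout and its peak value `localMaxwellian 1 (ϑ ^ 2) 0 0 = (2πϑ²)^{-3/2}`
serves as the sup bound of the kernel.

Contents.
* §1 Elementary real estimates: `x ↦ min(1, e^{-x})` is `1`-Lipschitz (so the Metropolis-weighted mark is bounded by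
  `sup |Ψ|` and `sup |Ψ|`-Lipschitz in the surprisal); a four-term triangle inequality; the Gaussian profile
  `t ↦ exp(-t²/(2ϑ²))` is `ϑ⁻¹`-Lipschitz (one-dimensional mean value theorem and `u ≤ exp(u²/2)`).
* §2 The kernel `v ↦ localMaxwellian 1 ϑ² v w = c_ϑ exp(-‖w - v‖²/(2ϑ²))` is bounded by `c_ϑ` and `c_ϑ ϑ⁻¹`-Lipschitz
  uniformly in `w` (reverse triangle inequality), so the KDE of a probability law is `c_ϑ ϑ⁻¹`-Lipschitz and
  continuous (positivity is `ParityRigidity.integral_localMaxwellian_pos`); `h^{ν_n}_ϑ(v) → h^ν_ϑ(v)` pointwise along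
  `ν_n → ν` weakly (bounded continuous kernel as a test function).
* §3 An equi-Lipschitz pointwise convergent sequence converges uniformly on compacts (Arzelà–Ascoli in the form
  `EquicontinuousOn.tendsto_uniformOnFun_iff_pi`); uniform convergence to a continuous positive limit on a compact
  passes to logarithms (`log` is Lipschitz away from `0`: `LongRangePhi4.abs_log_sub_log_le_div`); the energy
  sub-level sets `{‖v‖² ≤ r}` are compact; hence `log h^{ν_n}_ϑ → log h^ν_ϑ` uniformly on `{‖v‖² ≤ r}`.
* §4 By energy conservation of `collide`, uniform convergence of `G_n → g` on `{‖v‖² ≤ r}` gives uniform convergence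
  of the jumps `G_n(q.1.1) + G_n(q.1.2) - G_n(q'.1) - G_n(q'.2)` on `{‖q.1.1‖² + ‖q.1.2‖² ≤ r}` (`q' = collide q.2 q.1`),
  which the bounded Metropolis reweighting `Ψ min(1, e^{-·})` preserves; the jump of a continuous `g` is continuous.

References: P. Billingsley, *Convergence of Probability Measures* (1999), §2; Arzelà–Ascoli as in
`Mathlib.Topology.UniformSpace.Ascoli`.
-/

noncomputable section

namespace Summit.AtomisticToContinuum.HydrodynamicLimit.Theorems.ParityBandClosureSurprisalContinuity

open scoped BigOperators Topology Classical MeasureTheory ENNReal InnerProductSpace NNReal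
open Filter Set MeasureTheory
open Literature.MathematicalPhysics.KineticTheory Literature.Analysis.FluidPDE
open Summit.AtomisticToContinuum.HydrodynamicLimit.Theorems.ParityRigidity
open Literature.Barriers.CriticalPhenomena.LongRangePhi4 (abs_log_sub_log_le_div)

/-! ## §1 Elementary real-variable estimates -/

/-- The Metropolis factor `x ↦ min 1 (exp (-x))` is `1`-Lipschitz. -/
theorem abs_min_one_exp_neg_sub_le (x y : ℝ) :
    |min 1 (Real.exp (-x)) - min 1 (Real.exp (-y))| ≤ |x - y| := by
  have h1 : ∀ z : ℝ, min 1 (Real.exp (-z)) = Real.exp (-max z 0) := by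
    intro z
    rcases le_total 0 z with hz | hz
    · rw [max_eq_left hz, min_eq_right (Real.exp_le_one_iff.2 (neg_nonpos.2 hz))]
    · rw [max_eq_right hz, neg_zero, Real.exp_zero,
        min_eq_left (Real.one_le_exp_iff.2 (neg_nonneg.2 hz))]
  have key : ∀ a b : ℝ, 0 ≤ a → a ≤ b → |Real.exp (-a) - Real.exp (-b)| ≤ |a - b| := by
    intro a b ha hab
    have e1 : Real.exp (-b) = Real.exp (-a) * Real.exp (-(b - a)) := by
      rw [← Real.exp_add]; ring_nf
    have e2 : 1 - Real.exp (-(b - a)) ≤ b - a := by linarith [Real.add_one_le_exp (-(b - a))]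
    have e3 : Real.exp (-a) ≤ 1 := Real.exp_le_one_iff.2 (neg_nonpos.2 ha)
    have e4 : 0 ≤ 1 - Real.exp (-(b - a)) := sub_nonneg.2 (Real.exp_le_one_iff.2 (by linarith))
    rw [abs_of_nonneg (sub_nonneg.2 (Real.exp_le_exp.2 (neg_le_neg hab))), abs_sub_comm,
      abs_of_nonneg (sub_nonneg.2 hab)]
    calc Real.exp (-a) - Real.exp (-b) = Real.exp (-a) * (1 - Real.exp (-(b - a))) := by
          rw [e1]; ring
      _ ≤ 1 * (b - a) := mul_le_mul e3 e2 e4 zero_le_one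
      _ = b - a := one_mul _
  rw [h1, h1]
  refine le_trans ?_ (abs_max_sub_max_le_abs x y 0)
  rcases le_total (max x 0) (max y 0) with h | h
  · exact key _ _ (le_max_right _ _) h
  · rw [abs_sub_comm, abs_sub_comm (max x 0)]
    exact key _ _ (le_max_right _ _) h

/-- A Metropolis-weighted mark `a · min(1, e^{-x})` with `|a| ≤ C` is bounded by `C`. -/
theorem abs_mul_min_one_exp_neg_le {a C : ℝ} (h : |a| ≤ C) (x : ℝ) :
    |a * min 1 (Real.exp (-x))| ≤ C := by
  rw [abs_mul]
  have h1 : |min 1 (Real.exp (-x))| ≤ 1 := by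
    rw [abs_of_nonneg (le_min zero_le_one (Real.exp_pos _).le)]
    exact min_le_left _ _
  calc |a| * |min 1 (Real.exp (-x))| ≤ C * 1 := mul_le_mul h h1 (abs_nonneg _) ((abs_nonneg _).trans h)
    _ = C := mul_one C

/-- A Metropolis-weighted mark `a · min(1, e^{-x})` with `|a| ≤ C` is `C`-Lipschitz in the surprisal `x`. -/
theorem abs_mul_min_sub_mul_min_le {a C : ℝ} (h : |a| ≤ C) (x y : ℝ) :
    |a * min 1 (Real.exp (-x)) - a * min 1 (Real.exp (-y))| ≤ C * |x - y| := by
  rw [← mul_sub, abs_mul]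
  exact mul_le_mul h (abs_min_one_exp_neg_sub_le _ _) (abs_nonneg _) ((abs_nonneg _).trans h)

/-- Four-term triangle inequality for the surprisal jump. -/
theorem abs_sub_four_le (a b c d a' b' c' d' : ℝ) :
    |a + b - c - d - (a' + b' - c' - d')| ≤ |a - a'| + |b - b'| + |c - c'| + |d - d'| := by
  have h : a + b - c - d - (a' + b' - c' - d') = (a - a') + (b - b') - ((c - c') + (d - d')) := by ring
  rw [h]
  refine (abs_sub _ _).trans ?_
  linarith [abs_add_le (a - a') (b - b'), abs_add_le (c - c') (d - d')]

/-- The one-dimensional Gaussian profile `t ↦ exp (-t² / (2ϑ²))` is `ϑ⁻¹`-Lipschitz (mean value theorem; the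
derivative `-(t/ϑ²) exp(-t²/(2ϑ²))` has absolute value `≤ ϑ⁻¹` because `u ≤ exp (u²/2)`). -/
theorem abs_exp_neg_sq_sub_le {ϑ : ℝ} (hϑ : 0 < ϑ) (a b : ℝ) :
    |Real.exp (-a ^ 2 / (2 * ϑ ^ 2)) - Real.exp (-b ^ 2 / (2 * ϑ ^ 2))| ≤ ϑ⁻¹ * |a - b| := by
  have hd : ∀ t ∈ (Set.univ : Set ℝ), HasDerivWithinAt (fun t : ℝ => Real.exp (-t ^ 2 / (2 * ϑ ^ 2)))
      (Real.exp (-t ^ 2 / (2 * ϑ ^ 2)) * (-(2 * t) / (2 * ϑ ^ 2))) Set.univ t := by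
    intro t _
    have h1 : HasDerivAt (fun t : ℝ => -t ^ 2 / (2 * ϑ ^ 2)) (-(2 * t) / (2 * ϑ ^ 2)) t := by
      simpa using ((hasDerivAt_pow 2 t).neg).div_const (2 * ϑ ^ 2)
    exact h1.exp.hasDerivWithinAt
  have hb : ∀ t ∈ (Set.univ : Set ℝ),
      ‖Real.exp (-t ^ 2 / (2 * ϑ ^ 2)) * (-(2 * t) / (2 * ϑ ^ 2))‖ ≤ ϑ⁻¹ := by
    intro t _
    have hϑ2 : 0 < 2 * ϑ ^ 2 := by positivity
    rw [Real.norm_eq_abs, abs_mul, abs_of_pos (Real.exp_pos _), abs_div, abs_of_pos hϑ2, abs_neg,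
      abs_mul, abs_two, mul_div_mul_left _ _ (two_ne_zero), ← mul_div_assoc,
      div_le_iff₀ (by positivity : (0 : ℝ) < ϑ ^ 2),
      show ϑ⁻¹ * ϑ ^ 2 = ϑ by rw [sq, ← mul_assoc, inv_mul_cancel₀ hϑ.ne', one_mul]]
    have hx : Real.exp (-t ^ 2 / (2 * ϑ ^ 2)) * Real.exp (t ^ 2 / (2 * ϑ ^ 2)) = 1 := by
      rw [← Real.exp_add, neg_div, neg_add_cancel, Real.exp_zero]
    have hkey : |t| ≤ ϑ * Real.exp (t ^ 2 / (2 * ϑ ^ 2)) := by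
      have h3 : t ^ 2 / (2 * ϑ ^ 2) + 1 ≤ Real.exp (t ^ 2 / (2 * ϑ ^ 2)) := Real.add_one_le_exp _
      have h4 : |t| * (2 * ϑ) ≤ t ^ 2 + 2 * ϑ ^ 2 := by nlinarith [sq_nonneg (|t| - ϑ), sq_abs t]
      have h5 : |t| ≤ ϑ * (t ^ 2 / (2 * ϑ ^ 2) + 1) := by
        rw [show ϑ * (t ^ 2 / (2 * ϑ ^ 2) + 1) = (t ^ 2 + 2 * ϑ ^ 2) / (2 * ϑ) by
          field_simp]
        rwa [le_div_iff₀ (by positivity)]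
      exact h5.trans (mul_le_mul_of_nonneg_left h3 hϑ.le)
    calc Real.exp (-t ^ 2 / (2 * ϑ ^ 2)) * |t|
        ≤ Real.exp (-t ^ 2 / (2 * ϑ ^ 2)) * (ϑ * Real.exp (t ^ 2 / (2 * ϑ ^ 2))) := by gcongr
      _ = ϑ := by rw [mul_left_comm, hx, mul_one]
  have h := Convex.norm_image_sub_le_of_norm_hasDerivWithin_le hd hb convex_univ (Set.mem_univ b)
    (Set.mem_univ a)
  simpa only [Real.norm_eq_abs] using h

/-! ## §2 The Gaussian kernel and the KDE `h^μ_ϑ = ∫ localMaxwellian 1 ϑ² · w dμ(w)` -/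

/-- The peak value of the kernel is the normalising constant `c_ϑ = (2πϑ²)^{-3/2}`. -/
theorem localMaxwellian_zero_zero (ϑ : ℝ) :
    localMaxwellian 1 (ϑ ^ 2) (0 : V3) 0 = (2 * Real.pi * ϑ ^ 2) ^ (-(Module.finrank ℝ V3 : ℝ) / 2) := by
  simp [localMaxwellian]

/-- The kernel is its peak value times the Gaussian profile: `G_ϑ(v, w) = c_ϑ exp(-‖w - v‖²/(2ϑ²))`. -/
theorem localMaxwellian_eq_peak_mul (ϑ : ℝ) (v w : V3) :
    localMaxwellian 1 (ϑ ^ 2) v w =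
      localMaxwellian 1 (ϑ ^ 2) (0 : V3) 0 * Real.exp (-‖w - v‖ ^ 2 / (2 * ϑ ^ 2)) := by
  rw [localMaxwellian_zero_zero]
  simp only [localMaxwellian, one_mul]

/-- The peak value `c_ϑ` is positive. -/
theorem localMaxwellian_zero_zero_pos {ϑ : ℝ} (hϑ : 0 < ϑ) : 0 < localMaxwellian 1 (ϑ ^ 2) (0 : V3) 0 :=
  localMaxwellian_pos (by positivity) _ _

/-- The kernel is bounded by its peak value `c_ϑ`. -/
theorem norm_localMaxwellian_le {ϑ : ℝ} (hϑ : 0 < ϑ) (v w : V3) :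
    ‖localMaxwellian 1 (ϑ ^ 2) v w‖ ≤ localMaxwellian 1 (ϑ ^ 2) (0 : V3) 0 := by
  have h0 := (localMaxwellian_zero_zero_pos hϑ).le
  rw [localMaxwellian_eq_peak_mul, Real.norm_eq_abs, abs_of_nonneg (mul_nonneg h0 (Real.exp_pos _).le)]
  refine mul_le_of_le_one_right h0 (Real.exp_le_one_iff.2 ?_)
  rw [neg_div, neg_nonpos]
  positivity

/-- The kernel is `c_ϑ ϑ⁻¹`-Lipschitz in the evaluation point, uniformly in the integration variable. -/
theorem abs_localMaxwellian_sub_le {ϑ : ℝ} (hϑ : 0 < ϑ) (v₁ v₂ w : V3) :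
    |localMaxwellian 1 (ϑ ^ 2) v₁ w - localMaxwellian 1 (ϑ ^ 2) v₂ w| ≤
      localMaxwellian 1 (ϑ ^ 2) (0 : V3) 0 * ϑ⁻¹ * ‖v₁ - v₂‖ := by
  have h0 := (localMaxwellian_zero_zero_pos hϑ).le
  rw [localMaxwellian_eq_peak_mul ϑ v₁, localMaxwellian_eq_peak_mul ϑ v₂, ← mul_sub, abs_mul,
    abs_of_nonneg h0, mul_assoc]
  refine mul_le_mul_of_nonneg_left ?_ h0
  refine (abs_exp_neg_sq_sub_le hϑ ‖w - v₁‖ ‖w - v₂‖).trans ?_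
  refine mul_le_mul_of_nonneg_left ?_ (inv_nonneg.2 hϑ.le)
  calc |‖w - v₁‖ - ‖w - v₂‖| ≤ ‖(w - v₁) - (w - v₂)‖ := abs_norm_sub_norm_le _ _
    _ = ‖v₁ - v₂‖ := by rw [sub_sub_sub_cancel_left, norm_sub_rev]

/-- The kernel is integrable against every finite measure. -/
theorem integrable_localMaxwellian_right (μ : Measure V3) [IsFiniteMeasure μ] {ϑ : ℝ} (hϑ : 0 < ϑ)
    (v : V3) : Integrable (fun w => localMaxwellian 1 (ϑ ^ 2) v w) μ :=
  Integrable.of_bound (continuous_localMaxwellian (ϑ ^ 2) v).aestronglyMeasurable _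
    (ae_of_all _ fun w => norm_localMaxwellian_le hϑ v w)

/-- The KDE of a probability law is `c_ϑ ϑ⁻¹`-Lipschitz (metric form). -/
theorem dist_integral_localMaxwellian_le (μ : Measure V3) [IsProbabilityMeasure μ] {ϑ : ℝ} (hϑ : 0 < ϑ)
    (v₁ v₂ : V3) :
    dist (∫ w, localMaxwellian 1 (ϑ ^ 2) v₁ w ∂μ) (∫ w, localMaxwellian 1 (ϑ ^ 2) v₂ w ∂μ) ≤
      localMaxwellian 1 (ϑ ^ 2) (0 : V3) 0 * ϑ⁻¹ * dist v₁ v₂ := by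
  rw [Real.dist_eq, dist_eq_norm,
    ← integral_sub (integrable_localMaxwellian_right μ hϑ v₁) (integrable_localMaxwellian_right μ hϑ v₂)]
  have h := norm_integral_le_of_norm_le_const (μ := μ)
    (f := fun w => localMaxwellian 1 (ϑ ^ 2) v₁ w - localMaxwellian 1 (ϑ ^ 2) v₂ w)
    (C := localMaxwellian 1 (ϑ ^ 2) (0 : V3) 0 * ϑ⁻¹ * ‖v₁ - v₂‖)
    (ae_of_all _ fun w => by rw [Real.norm_eq_abs]; exact abs_localMaxwellian_sub_le hϑ v₁ v₂ w)
  simpa only [probReal_univ, mul_one, Real.norm_eq_abs] using h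

/-- The KDE of a probability law is `c_ϑ ϑ⁻¹`-Lipschitz. -/
theorem lipschitzWith_integral_localMaxwellian (μ : Measure V3) [IsProbabilityMeasure μ] {ϑ : ℝ}
    (hϑ : 0 < ϑ) :
    LipschitzWith ⟨localMaxwellian 1 (ϑ ^ 2) (0 : V3) 0 * ϑ⁻¹,
        mul_nonneg (localMaxwellian_zero_zero_pos hϑ).le (inv_nonneg.2 hϑ.le)⟩
      (fun v => ∫ w, localMaxwellian 1 (ϑ ^ 2) v w ∂μ) :=
  LipschitzWith.of_dist_le_mul fun v₁ v₂ => dist_integral_localMaxwellian_le μ hϑ v₁ v₂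

/-- The KDE of a probability law is continuous. -/
theorem continuous_integral_localMaxwellian (μ : Measure V3) [IsProbabilityMeasure μ] {ϑ : ℝ}
    (hϑ : 0 < ϑ) : Continuous fun v => ∫ w, localMaxwellian 1 (ϑ ^ 2) v w ∂μ :=
  (lipschitzWith_integral_localMaxwellian μ hϑ).continuous

/-- Pointwise convergence of the KDEs along a weakly convergent sequence of laws (the kernel is a bounded
continuous test function). -/
theorem tendsto_integral_localMaxwellian {νs : ℕ → ProbabilityMeasure V3} {ν : ProbabilityMeasure V3}
    (hν : Tendsto νs atTop (𝓝 ν)) {ϑ : ℝ} (hϑ : 0 < ϑ) (v : V3) :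
    Tendsto (fun n => ∫ w, localMaxwellian 1 (ϑ ^ 2) v w ∂(νs n : Measure V3)) atTop
      (𝓝 (∫ w, localMaxwellian 1 (ϑ ^ 2) v w ∂(ν : Measure V3))) :=
  ProbabilityMeasure.tendsto_iff_forall_integral_tendsto.1 hν
    (BoundedContinuousFunction.ofNormedAddCommGroup (localMaxwellian 1 (ϑ ^ 2) v)
      (continuous_localMaxwellian (ϑ ^ 2) v) _ (norm_localMaxwellian_le hϑ v))

/-! ## §3 Locally uniform convergence -/

/-- **Arzelà–Ascoli upgrade.** A pointwise convergent sequence of uniformly Lipschitz real functions on a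
pseudo-metric space converges uniformly on every compact set. -/
theorem tendstoUniformlyOn_of_lipschitzWith {X : Type*} [PseudoMetricSpace X] {Fs : ℕ → X → ℝ}
    {f : X → ℝ} {L : ℝ≥0} (hF : ∀ n, LipschitzWith L (Fs n))
    (hpt : ∀ x, Tendsto (fun n => Fs n x) atTop (𝓝 (f x))) {K : Set X} (hK : IsCompact K) :
    TendstoUniformlyOn Fs f atTop K := by
  have h1 : UniformEquicontinuous Fs := LipschitzWith.uniformEquicontinuous Fs L hF
  have h2 : ∀ K' ∈ {K' : Set X | IsCompact K'}, EquicontinuousOn Fs K' := fun K' _ =>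
    h1.equicontinuous.equicontinuousOn K'
  have hcov : ⋃₀ {K' : Set X | IsCompact K'} = Set.univ :=
    Set.eq_univ_of_forall fun x => Set.mem_sUnion_of_mem (Set.mem_singleton x) isCompact_singleton
  have h3 := (EquicontinuousOn.tendsto_uniformOnFun_iff_pi (fun K' hK' => hK') hcov h2 atTop f).2
    (tendsto_pi_nhds.2 hpt)
  exact (UniformOnFun.tendsto_iff_tendstoUniformlyOn.1 h3) K hK

/-- Uniform convergence on a compact set to a continuous positive limit passes to logarithms. -/
theorem tendstoUniformlyOn_log {X : Type*} [TopologicalSpace X] {Fs : ℕ → X → ℝ} {f : X → ℝ}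
    {K : Set X} (hK : IsCompact K) (hf : Continuous f) (hpos : ∀ x, 0 < f x)
    (h : TendstoUniformlyOn Fs f atTop K) :
    TendstoUniformlyOn (fun n x => Real.log (Fs n x)) (fun x => Real.log (f x)) atTop K := by
  rcases K.eq_empty_or_nonempty with rfl | hne
  · exact tendstoUniformlyOn_empty
  obtain ⟨x₀, -, hmin⟩ := hK.exists_isMinOn hne hf.continuousOn
  have hm0 : 0 < f x₀ := hpos x₀
  have hmK : ∀ x ∈ K, f x₀ ≤ f x := fun x hx => isMinOn_iff.1 hmin x hx
  rw [Metric.tendstoUniformlyOn_iff] at h ⊢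
  intro ε hε
  have hδ : 0 < min (f x₀ / 2) (ε * (f x₀ / 2)) := lt_min (by positivity) (by positivity)
  filter_upwards [h _ hδ] with n hn x hx
  have h1 := hn x hx
  rw [Real.dist_eq] at h1 ⊢
  have h2 : f x₀ / 2 ≤ Fs n x := by
    have := (abs_sub_lt_iff.1 (h1.trans_le (min_le_left _ _))).1
    linarith [hmK x hx]
  have h3 : f x₀ / 2 ≤ f x := by linarith [hmK x hx]
  calc |Real.log (f x) - Real.log (Fs n x)| ≤ |f x - Fs n x| / (f x₀ / 2) :=
        abs_log_sub_log_le_div (by positivity) h3 h2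
    _ < min (f x₀ / 2) (ε * (f x₀ / 2)) / (f x₀ / 2) := by gcongr
    _ ≤ ε * (f x₀ / 2) / (f x₀ / 2) := by gcongr; exact min_le_right _ _
    _ = ε := mul_div_cancel_right₀ ε (by positivity)

/-- The sub-level sets `{‖v‖² ≤ r}` of the kinetic energy on `V3` are compact. -/
theorem isCompact_normSqLe (r : ℝ) : IsCompact {v : V3 | ‖v‖ ^ 2 ≤ r} := by
  refine (isCompact_closedBall (0 : V3) (|r| + 1)).of_isClosed_subset
    (isClosed_le (continuous_norm.pow 2) continuous_const) fun v hv => ?_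
  rw [Metric.mem_closedBall, dist_zero_right]
  simp only [Set.mem_setOf_eq] at hv
  by_contra hlt
  rw [not_le] at hlt
  have h1 : 1 ≤ ‖v‖ := by linarith [abs_nonneg r]
  have h2 : ‖v‖ ≤ ‖v‖ ^ 2 := by nlinarith
  linarith [le_abs_self r]

/-- **Locally uniform convergence of the log-KDEs** (registered helper sub-goal of `stub_surprisalTestContinuity`, the
headline of this file).  Along `ν_n → ν` weakly, `log h^{ν_n}_ϑ → log h^ν_ϑ` uniformly on every energy sub-level set
`{‖v‖² ≤ r}` (equi-Lipschitz + pointwise convergence + Arzelà–Ascoli, then positivity and continuity of the limit KDE on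
the compact set). -/
theorem tendstoUniformlyOn_log_integral_localMaxwellian : ∀ (νs : ℕ → ProbabilityMeasure V3) (ν : ProbabilityMeasure V3), Tendsto νs atTop (𝓝 ν) → ∀ ϑ : ℝ, 0 < ϑ → ∀ r : ℝ, TendstoUniformlyOn (fun n v => Real.log (∫ w, localMaxwellian 1 (ϑ ^ 2) v w ∂(νs n : Measure V3))) (fun v => Real.log (∫ w, localMaxwellian 1 (ϑ ^ 2) v w ∂(ν : Measure V3))) atTop {v : V3 | ‖v‖ ^ 2 ≤ r} := by
  intro νs ν hν ϑ hϑ r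
  have hK := isCompact_normSqLe r
  have hu : TendstoUniformlyOn (fun n v => ∫ w, localMaxwellian 1 (ϑ ^ 2) v w ∂(νs n : Measure V3))
      (fun v => ∫ w, localMaxwellian 1 (ϑ ^ 2) v w ∂(ν : Measure V3)) atTop {v : V3 | ‖v‖ ^ 2 ≤ r} :=
    tendstoUniformlyOn_of_lipschitzWith (fun n => lipschitzWith_integral_localMaxwellian (νs n) hϑ)
      (tendsto_integral_localMaxwellian hν hϑ) hK
  exact tendstoUniformlyOn_log hK (continuous_integral_localMaxwellian ν hϑ)
    (integral_localMaxwellian_pos (ν : Measure V3) hϑ.ne') hu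

/-! ## §4 The jump across a collision and the Metropolis reweighting -/

/-- **Uniform convergence of collision jumps.**  If `G_n → g` uniformly on `{‖v‖² ≤ r}`, then the jumps
`G_n(q.1.1) + G_n(q.1.2) - G_n(q'.1) - G_n(q'.2)`, `q' = collide q.2 q.1`, converge uniformly on the energy sub-level
set `{‖q.1.1‖² + ‖q.1.2‖² ≤ r}` of `Q` (all four velocities lie in `{‖v‖² ≤ r}` by energy conservation). -/
theorem tendstoUniformlyOn_jump {G : ℕ → V3 → ℝ} {g : V3 → ℝ} {r : ℝ}
    (h : TendstoUniformlyOn G g atTop {v : V3 | ‖v‖ ^ 2 ≤ r}) :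
    TendstoUniformlyOn
      (fun n (q : (V3 × V3) × Metric.sphere (0 : V3) 1) =>
        G n q.1.1 + G n q.1.2 - G n (collide q.2 q.1).1 - G n (collide q.2 q.1).2)
      (fun q => g q.1.1 + g q.1.2 - g (collide q.2 q.1).1 - g (collide q.2 q.1).2) atTop
      {q | ‖q.1.1‖ ^ 2 + ‖q.1.2‖ ^ 2 ≤ r} := by
  rw [Metric.tendstoUniformlyOn_iff] at h ⊢
  intro ε hε
  filter_upwards [h (ε / 4) (by positivity)] with n hn q hq
  replace hq : ‖q.1.1‖ ^ 2 + ‖q.1.2‖ ^ 2 ≤ r := hq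
  have e := norm_sq_collide_fst_add_norm_sq_collide_snd q.2 q.1
  have hb : ∀ v : V3, ‖v‖ ^ 2 ≤ r → |g v - G n v| < ε / 4 := fun v hv => by
    have := hn v hv
    rwa [Real.dist_eq] at this
  have h1 := hb q.1.1 ((le_add_of_nonneg_right (sq_nonneg _)).trans hq)
  have h2 := hb q.1.2 ((le_add_of_nonneg_left (sq_nonneg _)).trans hq)
  have h3 := hb (collide q.2 q.1).1 ((le_add_of_nonneg_right (sq_nonneg _)).trans (e.le.trans hq))
  have h4 := hb (collide q.2 q.1).2 ((le_add_of_nonneg_left (sq_nonneg _)).trans (e.le.trans hq))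
  rw [Real.dist_eq]
  calc |g q.1.1 + g q.1.2 - g (collide q.2 q.1).1 - g (collide q.2 q.1).2 -
        (G n q.1.1 + G n q.1.2 - G n (collide q.2 q.1).1 - G n (collide q.2 q.1).2)| ≤ _ :=
      abs_sub_four_le _ _ _ _ _ _ _ _
    _ < ε / 4 + ε / 4 + ε / 4 + ε / 4 := by linarith
    _ = ε := by ring

/-- **The Metropolis reweighting preserves uniform convergence.**  If `Φ_n → φ` uniformly on `S` and `|Ψ| ≤ C`, then
`Ψ min(1, e^{-Φ_n}) → Ψ min(1, e^{-φ})` uniformly on `S`. -/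
theorem tendstoUniformlyOn_mul_min_one_exp_neg {X : Type*} {Φ : ℕ → X → ℝ} {φ : X → ℝ} {S : Set X}
    {Ψ : X → ℝ} {C : ℝ} (hC : ∀ x, |Ψ x| ≤ C) (h : TendstoUniformlyOn Φ φ atTop S) :
    TendstoUniformlyOn (fun n x => Ψ x * min 1 (Real.exp (-(Φ n x))))
      (fun x => Ψ x * min 1 (Real.exp (-(φ x)))) atTop S := by
  rw [Metric.tendstoUniformlyOn_iff] at h ⊢
  intro ε hε
  filter_upwards [h (ε / (|C| + 1)) (by positivity)] with n hn x hx
  have h1 := hn x hx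
  rw [Real.dist_eq] at h1 ⊢
  calc |Ψ x * min 1 (Real.exp (-(φ x))) - Ψ x * min 1 (Real.exp (-(Φ n x)))|
      ≤ C * |φ x - Φ n x| := abs_mul_min_sub_mul_min_le (hC x) _ _
    _ ≤ (|C| + 1) * |φ x - Φ n x| := by gcongr; linarith [le_abs_self C]
    _ < (|C| + 1) * (ε / (|C| + 1)) := by gcongr
    _ = ε := by field_simp

/-- The jump `g(q.1.1) + g(q.1.2) - g(q'.1) - g(q'.2)` of a continuous `g` across a collision is continuous on `Q`. -/
theorem continuous_jump {g : V3 → ℝ} (hg : Continuous g) :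
    Continuous fun q : (V3 × V3) × Metric.sphere (0 : V3) 1 =>
      g q.1.1 + g q.1.2 - g (collide q.2 q.1).1 - g (collide q.2 q.1).2 := by
  have hc : Continuous fun q : (V3 × V3) × Metric.sphere (0 : V3) 1 => collide q.2 q.1 := by
    unfold collide
    fun_prop
  exact (((hg.comp (continuous_fst.comp continuous_fst)).add
    (hg.comp (continuous_snd.comp continuous_fst))).sub (hg.comp (continuous_fst.comp hc))).sub
    (hg.comp (continuous_snd.comp hc))

end Summit.AtomisticToContinuum.HydrodynamicLimit.Theorems.ParityBandClosureSurprisalContinuity
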